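import Mathlib.Topology.Sequences
import Mathlib.Topology.Bases
import Literature.MathematicalPhysics.StatisticalMechanics.MuGroundStateConfiguration
import HarnessLib

/-!
# Sequential compactness of uniformly discrete point sets in the local matching topology

Topic: `Literature/MathematicalPhysics/StatisticalMechanics`. Companion to
`MuGroundStateConfiguration.lean` (`BallMatch`, `UniformlyDiscrete`) and to the class `𝔏` of
local limits of translated ground states (`LocalLimitOfGroundStates.lean`, definition request
`defn-IsLocalLimitOfGroundStates`, whose requester asks for "sequential compactness" of `𝔏`).

## Content

* `finite_of_forall_le_dist_of_subset_closedBall` — a `δ`-separated (`δ > 0`) subset of a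
  closed ball of `ℝᵈ` is finite (an infinite subset of a compact set has an accumulation
  point).
* `exists_subseq_forall_eventually_ballMatch` — **sequential compactness of `δ`-separated point
  sets in the local matching (local rubber) topology**: for every sequence `Y_k ⊆ ℝᵈ` of
  `δ`-separated sets (`δ > 0` fixed) there are a subsequence `φ` and a `δ`-separated set
  `Y ⊆ ℝᵈ` such that for every radius `R` and every `ε > 0`, eventually in `k`, `Y_(φ k)` and
  `Y` are two-way `ε`-matched on the ball `‖·‖ ≤ R` (`BallMatch ε R 0 (Y_(φ k)) Y`). This is the
  compactness of the space of uniformly discrete point sets of `ℝᵈ` in the local rubber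
  topology (Baake–Lenz 2004; Baake–Grimm 2013, Remark 5.6: "when working with non-FLC structures,
  a generalisation of the local topology is required if one wants to preserve compactness. For
  Delone sets, a useful concept is the local rubber topology … This topology is induced by the
  Hausdorff metric"), in sequential form and for sets that need not be relatively dense (the
  limit may be empty).

## Proof

Elementary diagonal/probe argument (no Hausdorff-metric machinery): fix a dense sequence `u`
of `ℝᵈ` and record, for every probe `(n, r) ∈ ℕ × ℚ`, whether `Y_k` meets the open ball
`B(u n, r)`; the space of probe tables `ℕ × ℚ → Bool` is compact and first countable, so along
a subsequence `φ` every probe is eventually constant. The limit is the Kuratowski lower limit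
`Y = kuratowskiLiminf (Y ∘ φ)`, the set of points `p` such that for every `ε > 0`, EVENTUALLY
in `k`, `Y_(φ k)` has a point within `ε` of `p`; by the probes, "frequently" implies
"eventually" along `φ` (`exists_subseq_mem_kuratowskiLiminf_of_frequently`), which gives the
matching of particles to `Y` by contradiction and compactness of closed balls; `Y` inherits the
`δ`-separation, so `Y ∩ B̄(0, R)` is finite and the matching of `Y` to particles is uniform.

## Use

With `IsLocalLimitOfGroundStates.of_eventually_ballMatch` and `.le_dist`
(`LocalLimitOfGroundStates.lean`): if the ground states of `V` have a uniform minimal distance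
`δ > 0`, every sequence in `𝔏` has a subsequence converging locally to a member of `𝔏`.

## References

* M. Baake, U. Grimm, *Aperiodic Order*, vol. 1, Cambridge Univ. Press 2013, Remark 5.6
  (p. 155) and §5.4.
* M. Baake, D. Lenz, *Dynamical systems on translation bounded measures: pure point dynamical
  and diffraction spectra*, Ergodic Theory Dynam. Systems 24 (2004), 1867–1893, §3 (cited
  through Baake–Grimm 2013).
-/

noncomputable section

open scoped Topology
open Filter Set Metric

namespace Literature.MathematicalPhysics.StatisticalMechanics

variable {d : ℕ}

/-! ## Separated subsets of balls are finite -/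

/-- A `δ`-separated subset (`δ > 0`) of a closed ball of `ℝᵈ` is finite: an infinite subset of
the compact ball would have an accumulation point, near which two distinct points of the set
would be closer than `δ`. [folklore] -/
theorem finite_of_forall_le_dist_of_subset_closedBall {S : Set (EuclideanSpace ℝ (Fin d))}
    {δ : ℝ} (hδ : 0 < δ) (hsep : ∀ p ∈ S, ∀ q ∈ S, p ≠ q → δ ≤ dist p q)
    {c : EuclideanSpace ℝ (Fin d)} {R : ℝ} (hS : S ⊆ closedBall c R) : S.Finite := by
  by_contra hinf
  obtain ⟨a, -, ha⟩ :=
    Set.Infinite.exists_accPt_of_subset_isCompact hinf (isCompact_closedBall c R) hS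
  rw [accPt_iff_nhds] at ha
  obtain ⟨y₁, ⟨hy₁U, hy₁S⟩, hy₁a⟩ := ha (ball a (δ / 2)) (ball_mem_nhds a (half_pos hδ))
  have hr : 0 < dist y₁ a := dist_pos.2 hy₁a
  obtain ⟨y₂, ⟨hy₂U, hy₂S⟩, -⟩ := ha (ball a (dist y₁ a)) (ball_mem_nhds a hr)
  rw [mem_ball] at hy₁U hy₂U
  have hne : y₁ ≠ y₂ := fun h => by
    rw [h] at hy₂U
    exact lt_irrefl _ hy₂U
  have h1 := hsep y₁ hy₁S y₂ hy₂S hne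
  have : dist y₁ y₂ < δ :=
    calc dist y₁ y₂ ≤ dist y₁ a + dist y₂ a := dist_triangle_right _ _ _
      _ < δ / 2 + δ / 2 := add_lt_add hy₁U (hy₂U.trans hy₁U)
      _ = δ := by ring
  linarith

/-! ## The limit set of a sequence of point sets -/

/-- The **Kuratowski lower limit** `Li Z_k` of a sequence of point sets `Z_k ⊆ ℝᵈ`: the points
`p` such that for every `ε > 0`, eventually in `k`, `Z_k` has a point within `ε` of `p`
(equivalently `dist(p, Z_k) → 0`). [folklore] -/
def kuratowskiLiminf (Z : ℕ → Set (EuclideanSpace ℝ (Fin d))) : Set (EuclideanSpace ℝ (Fin d)) :=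
  {p | ∀ ε : ℝ, 0 < ε → ∀ᶠ k in atTop, ∃ q ∈ Z k, dist q p < ε}

/-- Unfolding of `kuratowskiLiminf`. [folklore] -/
theorem mem_kuratowskiLiminf_iff {Z : ℕ → Set (EuclideanSpace ℝ (Fin d))}
    {p : EuclideanSpace ℝ (Fin d)} :
    p ∈ kuratowskiLiminf Z ↔ ∀ ε : ℝ, 0 < ε → ∀ᶠ k in atTop, ∃ q ∈ Z k, dist q p < ε :=
  Iff.rfl

/-- The limit set of `δ`-separated sets is `δ`-separated. [folklore] -/
theorem le_dist_of_mem_kuratowskiLiminf {Z : ℕ → Set (EuclideanSpace ℝ (Fin d))} {δ : ℝ}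
    (hsep : ∀ k, ∀ p ∈ Z k, ∀ q ∈ Z k, p ≠ q → δ ≤ dist p q)
    {p q : EuclideanSpace ℝ (Fin d)} (hp : p ∈ kuratowskiLiminf Z) (hq : q ∈ kuratowskiLiminf Z)
    (hpq : p ≠ q) : δ ≤ dist p q := by
  have hpq0 : 0 < dist p q := dist_pos.2 hpq
  refine le_of_forall_pos_lt_add fun η hη => ?_
  set ε : ℝ := min (η / 4) (dist p q / 4) with hε
  have hε0 : 0 < ε := lt_min (by linarith) (by linarith)
  have hεη : ε ≤ η / 4 := min_le_left _ _
  have hεpq : ε ≤ dist p q / 4 := min_le_right _ _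
  obtain ⟨k, ⟨a, ha, hap⟩, ⟨b, hb, hbq⟩⟩ := ((hp ε hε0).and (hq ε hε0)).exists
  by_cases hab : a = b
  · subst hab
    have : dist p q < 2 * ε :=
      calc dist p q ≤ dist a p + dist a q := dist_triangle_left _ _ _
        _ < ε + ε := add_lt_add hap hbq
        _ = 2 * ε := by ring
    linarith
  · have h1 := hsep k a ha b hb hab
    have : dist a b < dist p q + 2 * ε :=
      calc dist a b ≤ dist a p + dist p b := dist_triangle _ _ _
        _ ≤ dist a p + (dist p q + dist b q) := add_le_add le_rfl (dist_triangle_right _ _ _)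
        _ < ε + (dist p q + ε) := add_lt_add_of_lt_of_le hap (add_le_add le_rfl hbq.le)
        _ = dist p q + 2 * ε := by ring
    linarith

/-! ## Sequential compactness -/

/-- **Probe extraction.** For every sequence of point sets `Y_k ⊆ ℝᵈ` there is a subsequence
`φ` along which approach is stable: whenever `Y_(φ k)` comes within every `ε` of a point `p`
for infinitely many `k`, it does so for all large `k`, i.e. `p ∈ kuratowskiLiminf (Y ∘ φ)`.
(Record for each probe ball `B(u n, r)`, `u` a dense sequence, `r ∈ ℚ`, whether `Y_k` meets
it; extract a subsequence along which every probe is eventually constant, by compactness and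
first countability of `ℕ × ℚ → Bool`.) [folklore] -/
theorem exists_subseq_mem_kuratowskiLiminf_of_frequently
    (Ys : ℕ → Set (EuclideanSpace ℝ (Fin d))) :
    ∃ φ : ℕ → ℕ, StrictMono φ ∧ ∀ p : EuclideanSpace ℝ (Fin d),
      (∀ ε : ℝ, 0 < ε → ∃ᶠ k in atTop, ∃ q ∈ Ys (φ k), dist q p < ε) →
        p ∈ kuratowskiLiminf (fun k => Ys (φ k)) := by
  classical
  obtain ⟨u, hu⟩ := TopologicalSpace.exists_dense_seq (EuclideanSpace ℝ (Fin d))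
  let probe : ℕ → (ℕ × ℚ → Bool) := fun k nr =>
    decide (∃ q ∈ Ys k, dist q (u nr.1) < ((nr.2 : ℚ) : ℝ))
  obtain ⟨L, φ, hφ, hL⟩ := CompactSpace.tendsto_subseq probe
  -- every probe is eventually constant along `φ`; hence frequently meeting ⟹ eventually meeting
  have hKey0 : ∀ (n : ℕ) (r : ℚ), (∃ᶠ k in atTop, ∃ q ∈ Ys (φ k), dist q (u n) < (r : ℝ)) →
      ∀ᶠ k in atTop, ∃ q ∈ Ys (φ k), dist q (u n) < (r : ℝ) := by
    intro n r hfr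
    have ht : Tendsto (fun k => probe (φ k) (n, r)) atTop (𝓝 (L (n, r))) :=
      tendsto_pi_nhds.1 hL (n, r)
    rw [nhds_discrete Bool, tendsto_pure] at ht
    cases hLnr : L (n, r) with
    | true =>
      filter_upwards [ht] with k hk
      rw [hLnr] at hk
      simpa [probe] using hk
    | false =>
      exfalso
      obtain ⟨k, hk1, hk2⟩ := (hfr.and_eventually ht).exists
      rw [hLnr] at hk2
      simp only [probe, decide_eq_false_iff_not] at hk2
      exact hk2 hk1
  refine ⟨φ, hφ, fun p hp ε hε => ?_⟩
  -- a rational radius `r < ε / 2` and a probe centre within `r / 2` of `p`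
  obtain ⟨r, hr0, hrε⟩ := exists_rat_btwn (half_pos hε)
  have hr0' : (0 : ℝ) < r := by exact_mod_cast hr0
  obtain ⟨n, hn⟩ := hu.exists_dist_lt p (half_pos hr0')
  have hfr : ∃ᶠ k in atTop, ∃ q ∈ Ys (φ k), dist q (u n) < (r : ℝ) := by
    refine (hp (r / 2) (half_pos hr0')).mono fun k ⟨q, hq, hqp⟩ => ⟨q, hq, ?_⟩
    calc dist q (u n) ≤ dist q p + dist p (u n) := dist_triangle _ _ _
      _ < r / 2 + r / 2 := add_lt_add hqp hn
      _ = r := by ring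
  filter_upwards [hKey0 n r hfr] with k ⟨q, hq, hqn⟩
  refine ⟨q, hq, ?_⟩
  calc dist q p ≤ dist q (u n) + dist p (u n) := dist_triangle_right _ _ _
    _ < r + r / 2 := add_lt_add hqn hn
    _ < ε := by linarith

/-- **Sequential compactness of uniformly discrete point sets in the local matching topology**
(Baake–Lenz 2004; Baake–Grimm 2013, Remark 5.6, sequential form, sets not necessarily
relatively dense). Let `δ > 0` and let `Y_k ⊆ ℝᵈ` be `δ`-separated for every `k`. Then there
are a strictly increasing `φ : ℕ → ℕ` and a `δ`-separated `Y ⊆ ℝᵈ` (possibly empty) such that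
for every `R` and every `ε > 0`, eventually in `k`, `Y_(φ k)` and `Y` are two-way `ε`-matched
on the closed ball of radius `R` about `0`: `BallMatch ε R 0 (Y_(φ k)) Y`. [folklore] -/
theorem exists_subseq_forall_eventually_ballMatch {δ : ℝ} (hδ : 0 < δ)
    (Ys : ℕ → Set (EuclideanSpace ℝ (Fin d)))
    (hsep : ∀ k, ∀ p ∈ Ys k, ∀ q ∈ Ys k, p ≠ q → δ ≤ dist p q) :
    ∃ (φ : ℕ → ℕ) (Y : Set (EuclideanSpace ℝ (Fin d))), StrictMono φ ∧
      (∀ p ∈ Y, ∀ q ∈ Y, p ≠ q → δ ≤ dist p q) ∧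
      ∀ R ε : ℝ, 0 < ε → ∀ᶠ k in atTop, BallMatch ε R 0 (Ys (φ k)) Y := by
  obtain ⟨φ, hφ, hKey⟩ := exists_subseq_mem_kuratowskiLiminf_of_frequently Ys
  set Y := kuratowskiLiminf (fun k => Ys (φ k)) with hY
  have hsepφ : ∀ k, ∀ p ∈ Ys (φ k), ∀ q ∈ Ys (φ k), p ≠ q → δ ≤ dist p q := fun k => hsep (φ k)
  have hYsep : ∀ p ∈ Y, ∀ q ∈ Y, p ≠ q → δ ≤ dist p q :=
    fun p hp q hq hpq => le_dist_of_mem_kuratowskiLiminf hsepφ hp hq hpq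
  refine ⟨φ, Y, hφ, hYsep, fun R ε hε => ?_⟩
  -- (1) points of `Y` in the ball are matched: finitely many, each eventually approached
  have hfin : (Y ∩ closedBall 0 R).Finite :=
    finite_of_forall_le_dist_of_subset_closedBall hδ
      (fun p hp q hq hpq => hYsep p hp.1 q hq.1 hpq) inter_subset_right
  have h1 : ∀ᶠ k in atTop, ∀ p ∈ Y ∩ closedBall (0 : EuclideanSpace ℝ (Fin d)) R,
      ∃ q ∈ Ys (φ k), dist q p < ε :=
    hfin.eventually_all.2 fun p hp => hp.1 ε hε
  -- (2) particles in the ball are matched: by contradiction and compactness of the ball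
  have h2 : ∀ᶠ k in atTop, ∀ q ∈ Ys (φ k), ‖q‖ ≤ R → ∃ p ∈ Y, dist q p ≤ ε := by
    by_contra hcon
    obtain ⟨ψ, hψ, hψP⟩ := extraction_of_frequently_atTop (not_eventually.1 hcon)
    have hq : ∀ l, ∃ q ∈ Ys (φ (ψ l)), ‖q‖ ≤ R ∧ ∀ p ∈ Y, ε < dist q p := by
      intro l
      have := hψP l
      push Not at this
      exact this
    choose q hqY hqR hfar using hq
    obtain ⟨a, -, θ, hθ, hlimq⟩ :=
      (isCompact_closedBall (0 : EuclideanSpace ℝ (Fin d)) R).tendsto_subseq (x := q)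
        fun l => mem_closedBall_zero_iff.2 (hqR l)
    have ha : a ∈ Y := by
      refine hKey a fun ε' hε' => ?_
      have hi : ∀ᶠ i in atTop, dist (q (θ i)) a < ε' := Metric.tendsto_nhds.1 hlimq ε' hε'
      refine frequently_atTop.2 fun K => ?_
      obtain ⟨i, hi', hiK⟩ := (hi.and (eventually_ge_atTop K)).exists
      exact ⟨ψ (θ i), hiK.trans (hθ.le_apply.trans hψ.le_apply), q (θ i), hqY (θ i), hi'⟩
    obtain ⟨i, hi⟩ := (Metric.tendsto_nhds.1 hlimq ε hε).exists
    exact lt_irrefl _ ((hfar (θ i) a ha).trans hi)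
  filter_upwards [h1, h2] with k hk1 hk2
  refine ⟨fun s hs hsR => ?_, fun a ha haR => ?_⟩
  · obtain ⟨b, hb, hbs⟩ := hk1 s ⟨hs, mem_closedBall.2 hsR⟩
    exact ⟨b, hb, hbs.le⟩
  · exact hk2 a ha (by rwa [dist_zero_right] at haR)

/-- The same with the conclusion phrased through `UniformlyDiscrete` for a sequence of subsets
of ONE uniformly discrete family: if all `Y_k` are `δ`-separated for a common `δ > 0`, some
subsequence converges locally to a uniformly discrete limit. [folklore] -/
theorem exists_subseq_forall_eventually_ballMatch_uniformlyDiscrete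
    (Ys : ℕ → Set (EuclideanSpace ℝ (Fin d)))
    (h : ∃ δ : ℝ, 0 < δ ∧ ∀ k, ∀ p ∈ Ys k, ∀ q ∈ Ys k, p ≠ q → δ ≤ dist p q) :
    ∃ (φ : ℕ → ℕ) (Y : Set (EuclideanSpace ℝ (Fin d))), StrictMono φ ∧ UniformlyDiscrete Y ∧
      ∀ R ε : ℝ, 0 < ε → ∀ᶠ k in atTop, BallMatch ε R 0 (Ys (φ k)) Y := by
  obtain ⟨δ, hδ, hsep⟩ := h
  obtain ⟨φ, Y, hφ, hY, hlim⟩ := exists_subseq_forall_eventually_ballMatch hδ Ys hsep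
  exact ⟨φ, Y, hφ, ⟨δ, hδ, hY⟩, hlim⟩

end Literature.MathematicalPhysics.StatisticalMechanics

end
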